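import Summits.QuantumFields.BalabanUV.Beta.GAN24.CombSlotLegSplit
import Summits.QuantumFields.BalabanUV.Beta.GAN24.CarrierSlotLegBottomKernelRate
import Summits.QuantumFields.BalabanUV.Beta.GAN24.KSlotCombChart

/-!
# `BalabanUV.Beta.GAN24.CombCarrierSlotLegBottomKernelRate` — binder row G-an2-4 ∕ (CONV-C), TRANSFER-III (the (III′) column of RULING R-gan24p1-g46-2), THE COMB LEG DICTIONARY,
# ELEVENTH WORD = THE PART-8b′ TWIN: **THE COMPOSITE SLOT LEGS OF THE SWAPPED COMB-CHART FAMILY HAVE ONE BLOCK-LABEL RATE FOR EVERY LENGTH** — `∃ κ₈ > 0, ∀ q, ∃ a₈ ≥ 0, …`: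
# for the family `G″ := update G′♮ p M` (`G′♮_j := unitK (sfStep Lc j) (smStep 3 Lc j) (GcombSh Lc j)`, `Decays M CM δM`),
# `|legChain (colH ∘ G″) p q μ y κ v| ≤ CM·a₈·e^{−κ₈‖quo (Lc^{q+1}) v − y‖∞}` (+ the crude unit gradient) with `κ₈` chosen BEFORE the length `q`
# (OWNER `b2b-balaban-gan24-p1`, gen 48; MY part 8b′ `CarrierSlotLegBottomKernelRate` §3 re-run BY NAME on the seventh word and on the (III′) K-slot; no existing file touched)

NOT IN PRINT; OUR BOOKKEEPING ([folklore] re-indexing BY NAME, the (E) proof token for token with `coDressKBmAt (toSite rr) Lc (KInvStep Lc j) ↦ GcombSh Lc j`, the root quantifier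
dropped (centred by construction), the potential `Ψ − bmGaugeAt ↦ Ψ + PsiFace − bmGaugeAt`: the NATURAL composite slot leg above the bottom level is the seventh word's
`CombSlotLegSplit.legChain_comb_colH_eq ∕ exists_comb_slotLeg_envelopes` (`respStep + d_z(Ψ + PsiFace − bm gauge)`, block-label rate `κb` independent of the length), the levelwise
decay of the comb-chart unit step kernels is gan24-formalise-leaf-02 g77's (III′) K-slot `KSlotCombChart.kSlotCombSh_holds` (the row `∀ j, Decays G′♮_j C δ` — the DEDUP of a part-7
twin: leaf-02's file IS the (III′) pair part 7 `DressedStepDifferenceRows` supplies at (E)), the composition with `colH M` below and the crude gradient are MY part 8b′'s GENERIC §1∕§2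
(`abs_legComp_colH_le`, `abs_sub_le_of_env`), MY part 8b's `legChain_congr_from ∕ legDecay_colH_update ∕ abs_le_env_of_legDecay`; 0 `def`, 0 cited facts, 0 `def … : Prop`, 0 sorry).
HONEST FRAMING (cell contract, verbatim): «discharging `BetaPertH` makes Bałaban's UV stability UNCONDITIONAL — a real constructive-QFT result; it is NOT the continuum limit and NOT
the Clay problem.»  HONEST DEPENDENCY (verbatim): «continuum YM on T⁴ ⇐ BetaPertH ∧ nine spine estimates (0/9 proved); BetaPertH ⇐ (D1) ∧ (D4) ∧ CAP+tail; G-an2-4 gates asym,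
D1 and NE2/3/4.»

WHY (the rate ORDER, MY (E) part 8b′ ∕ journal INFO [GAN24P1-G38-ONLINE], unchanged at (III′)): gan24-formalise-leaf-03 g81's W4 fixes `(δ, δD)` BEFORE `k₀`; the drift windows `HWΔ`
read the legs at rate `18(d+1)·δD`, so the legs' rate ceiling must not depend on the window length `q < k₀` — the `∃ κ₈ ∀ q` form the twelfth word `CombNaturalWindowDrift` consumes.
WHAT (`d = 3`, `2 ≤ Lc`): **`exists_comb_slotLeg_bottomKernel_envelopes_rate`** — part 8b′'s `exists_dressed_slotLeg_bottomKernel_envelopes_rate` VERBATIM for the comb-chart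
kernels, no root quantifier: `κ₈ := min κb (δM∕2)` from the seventh word's `κb`; for `q = k+1` the chain is `legComp (colH M Lc) (legChain (colH ∘ G′♮) (p+1) k)` (`legChain_succ_left`
⨾ `legChain_congr_from`), the upper chain `= respStep (Lc^{p+1}) (Lc^{p+k+2}) + d_z(Ψ + PsiFace − bm gauge)` with envelope `(Cr + Cφ·(e^{κb}+1))·e^{−κb‖quo(Lc^{k+1}) v − y‖∞}` (powers of
`Lc` dropped); `q = 0` is `colH M` alone (rate `δM ≥ κ₈`).
Asserts NOTHING about Bałaban's tables beyond the tree's LANDED K-slot at (III′); NOT (H1Δw); NOTHING of (Q-L) ∕ (C)sym discharged; the (III′) campaign is NOT asked (an2 W-4) —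
typed under R-2; NEVER «G-an2-4 closed» as (CONV-C); NOT D1, NOT `BetaPertH`, NOT continuum, NOT Clay; not in print.  Unit `b2b-balaban-gan24-p1` (BINDER row G-an2-4 OWNER),
gen 48, 2026-08-25.
-/

noncomputable section

open Finset
open scoped BigOperators
open Literature.MathematicalPhysics.QuantumFieldTheory
open Literature.MathematicalPhysics.QuantumFieldTheory.LatticeForm (quo)
open Literature.MathematicalPhysics.QuantumFieldTheory.Balaban1983to89
open Literature.MathematicalPhysics.QuantumFieldTheory.Balaban1983to89.Beta
open B4ContourShift (supNorm supNorm_nonneg)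
open B6BondElimination (unitVec)
open B12Sec2to5 (l1 l1_nonneg)
open ExpKernelCalculus (MKer Decays Zl Zl_nonneg)
open OneStepResolventKernel (Fib)
open OneStepKernelFamily (colH)
open AffineAveraging (Site box toSite)
open AveragingContoursRooted (ctrOff ctrOff_mem_box)
open BalabanCompositeJets (respStep)
open Summit.QuantumFields.BalabanUV.Beta.HessKerDressedUnits (unitK)
open Summit.QuantumFields.BalabanUV.Beta.AxialProjectorBlockMean (bmGaugeAt)
open Summit.QuantumFields.BalabanUV.Beta.CombChartStepJets (GcombSh)
open Summit.QuantumFields.BalabanUV.Beta.GAN24.CombesThomas (sfStep smStep)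
open Summit.QuantumFields.BalabanUV.Beta.GAN24.Push4 (legComp)
open Summit.QuantumFields.BalabanUV.Beta.GAN24.Push4Bounds (LegDecay legDecay_colH)
open Summit.QuantumFields.BalabanUV.Beta.GAN24.Push4Iter (LegFam legChain legChain_zero)
open Summit.QuantumFields.BalabanUV.Beta.GAN24.LegCompAssoc (legChain_succ_left)
open Summit.QuantumFields.BalabanUV.Beta.GAN24.EnvelopeBlockSum (env_wobble)
open Summit.QuantumFields.BalabanUV.Beta.GAN24.RespStepBmDecompLegs (legAct)
open Summit.QuantumFields.BalabanUV.Beta.GAN24.RespStepBmDecompPsi (Psi)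
open Summit.QuantumFields.BalabanUV.Beta.GAN24.CombLegChainGauge (PsiFace)
open Summit.QuantumFields.BalabanUV.Beta.GAN24.DressedStepDifferenceRows (nonneg_of_decays)
open Summit.QuantumFields.BalabanUV.Beta.GAN24.KSlotCombChart (kSlotCombSh_holds)
open Summit.QuantumFields.BalabanUV.Beta.GAN24.CombSlotLegSplit (legChain_comb_colH_eq exists_comb_slotLeg_envelopes)
open Summit.QuantumFields.BalabanUV.Beta.GAN24.CarrierSlotLegBottomKernel (legChain_congr_from legDecay_colH_update abs_le_env_of_legDecay)
open Summit.QuantumFields.BalabanUV.Beta.GAN24.CarrierSlotLegBottomKernelRate (abs_legComp_colH_le abs_sub_le_of_env)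

namespace Summit.QuantumFields.BalabanUV.Beta.GAN24.CombCarrierSlotLegBottomKernelRate

variable {Lc : ℕ} [NeZero Lc]

/-- NOT IN PRINT; OUR BOOKKEEPING.  **THE COMPOSITE SLOT LEGS OF THE SWAPPED COMB-CHART FAMILY — ONE RATE FOR EVERY LENGTH** (as displayed in the module docstring; `d = 3`,
`2 ≤ Lc`): for every `δM > 0` ONE rate `κ₈ > 0` and, for every length `q`, ONE `a₈ ≥ 0` with, for every kernel `M` with `Decays M CM δM` (`0 ≤ CM`), every level `p` and all
`μ y κ v i`: sup `≤ CM·a₈·e^{−κ₈‖quo (Lc^{q+1}) v − y‖∞}` and crude unit gradient `≤ CM·a₈·(e^{κ₈}+1)·e^{−κ₈‖quo (Lc^{q+1}) v − y‖∞}` for `legChain (colH ∘ update G′♮ p M) p q` —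
MY part 8b′ `exists_dressed_slotLeg_bottomKernel_envelopes_rate` VERBATIM for the comb-chart kernels (no root quantifier). -/
theorem exists_comb_slotLeg_bottomKernel_envelopes_rate (hLc : 2 ≤ Lc) {δM : ℝ} (hδM : 0 < δM) :
    ∃ κ₈ : ℝ, 0 < κ₈ ∧ ∀ q : ℕ, ∃ a₈ : ℝ, 0 ≤ a₈ ∧
      ∀ (M : MKer (3 + 1) (Fib 3)) (CM : ℝ), 0 ≤ CM → Decays M CM δM → ∀ (p : ℕ) (μ : Fin (3 + 1)) (y : Site (3 + 1)) (κ : Fin (3 + 1)) (v : Site (3 + 1)),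
        |legChain (fun j => colH (Function.update (fun j => unitK (sfStep Lc j) (smStep 3 Lc j) (GcombSh (d := 3) Lc j)) p M j) Lc) p q μ y κ v|
            ≤ CM * a₈ * Real.exp (-(κ₈ * supNorm (quo (Lc ^ (q + 1)) v - y))) ∧
        ∀ i : Fin (3 + 1),
          |legChain (fun j => colH (Function.update (fun j => unitK (sfStep Lc j) (smStep 3 Lc j) (GcombSh (d := 3) Lc j)) p M j) Lc) p q μ y κ (v + Pi.single i 1)
            - legChain (fun j => colH (Function.update (fun j => unitK (sfStep Lc j) (smStep 3 Lc j) (GcombSh (d := 3) Lc j)) p M j) Lc) p q μ y κ v|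
            ≤ CM * a₈ * (Real.exp κ₈ + 1) * Real.exp (-(κ₈ * supNorm (quo (Lc ^ (q + 1)) v - y))) := by
  classical
  have hLc1 : 1 ≤ Lc := le_trans (by norm_num) hLc
  have hL1 : (1 : ℝ) ≤ Lc := by exact_mod_cast hLc1
  -- the comb-chart family's levelwise decay (the (III′) K-slot) and the natural composite slot legs' envelopes (the seventh word)
  obtain ⟨C, δK, cK, θ, hδK, -, -, hKrow, -⟩ := kSlotCombSh_holds (Lc := Lc) hLc
  have hC : 0 ≤ C := nonneg_of_decays (hKrow 0)
  obtain ⟨κb, Cr, Cr', Cφ, hκb, hCr, hCr', hCφ, hENV⟩ := exists_comb_slotLeg_envelopes (Lc := Lc) hLc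
  set κ₈ : ℝ := min κb (δM / 2) with hκ₈
  have hκ₈0 : 0 < κ₈ := lt_min hκb (by linarith)
  have hκ₈M : κ₈ ≤ δM := (min_le_right _ _).trans (by linarith)
  refine ⟨κ₈, hκ₈0, fun q => ?_⟩
  cases q with
  | zero =>
    -- the length-one leg: `colH M` alone, at rate `δM ≥ κ₈`
    refine ⟨1, zero_le_one, ?_⟩
    intro M CM hCM hM p μ y κ v
    have hsup : ∀ v, |legChain (fun j => colH (Function.update (fun j => unitK (sfStep Lc j) (smStep 3 Lc j) (GcombSh (d := 3) Lc j)) p M j) Lc) p 0 μ y κ v|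
        ≤ CM * 1 * Real.exp (-(κ₈ * supNorm (quo (Lc ^ (0 + 1)) v - y))) := by
      intro v
      rw [legChain_zero, Function.update_self, mul_one, zero_add, pow_one]
      have h := abs_le_env_of_legDecay (d := 3) hLc1 (legDecay_colH (N := Lc) hM) hδM.le μ y κ v
      refine h.trans (mul_le_mul_of_nonneg_left (Real.exp_le_exp.2 ?_) hCM)
      have := supNorm_nonneg (quo Lc v - y); nlinarith
    refine ⟨hsup v, fun i => ?_⟩
    have hq1 : 1 ≤ Lc ^ (0 + 1) := Nat.one_le_pow _ _ hLc1
    exact abs_sub_le_of_env (d := 3) hq1 (R := fun v => legChain (fun j => colH (Function.update (fun j => unitK (sfStep Lc j) (smStep 3 Lc j)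
      (GcombSh (d := 3) Lc j)) p M j) Lc) p 0 μ y κ v) (by positivity) hκ₈0.le y hsup v i
  | succ k =>
    -- length ≥ 2: the natural comb-chart composite slot leg above, `colH M` below
    set A : ℝ := Cr + Cφ * (Real.exp κb + 1) with hA
    have hA0 : 0 ≤ A := by rw [hA]; positivity
    set a₈ : ℝ := ((3 + 1 : ℕ) : ℝ) * A * Zl (3 + 1) (δM / 2) with ha₈
    have hZ := Zl_nonneg (D := 3 + 1) (show 0 < δM / 2 by linarith)
    have ha₈0 : 0 ≤ a₈ := by rw [ha₈]; positivity
    refine ⟨a₈, ha₈0, ?_⟩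
    intro M CM hCM hM p μ y κ v
    have hq1 : 1 ≤ Lc ^ (k + 1 + 1) := Nat.one_le_pow _ _ hLc1
    -- the upper chain's envelope at rate `κb`, powers of `Lc` dropped
    obtain ⟨hr0, -, hφ0⟩ := hENV (p + 1) k
    have hE := legChain_comb_colH_eq (d := 3) (Lc := Lc) (p + 1) k
    have hU : ∀ (μ : Fin (3 + 1)) (y : Site (3 + 1)) (lam : Fin (3 + 1)) (v : Site (3 + 1)),
        |legChain (fun j => colH (unitK (sfStep Lc j) (smStep 3 Lc j) (GcombSh (d := 3) Lc j)) Lc) (p + 1) k μ y lam v|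
          ≤ A * Real.exp (-(κb * supNorm (quo (Lc ^ (k + 1)) v - y))) := by
      intro μ y lam v
      rw [hE]
      have hk1 : 1 ≤ Lc ^ (k + 1) := Nat.one_le_pow _ _ hLc1
      have hp5 : ((Lc : ℝ) ^ (5 * (k + 1)))⁻¹ ≤ 1 := inv_le_one_of_one_le₀ (one_le_pow₀ hL1)
      have hp4 : ((Lc : ℝ) ^ (4 * (k + 1)))⁻¹ ≤ 1 := inv_le_one_of_one_le₀ (one_le_pow₀ hL1)
      have hE0 : 0 ≤ Real.exp (-(κb * supNorm (quo (Lc ^ (k + 1)) v - y))) := (Real.exp_pos _).le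
      have h1 : |respStep (d := 3) (Lc ^ (p + 1)) (Lc ^ (p + 1 + k + 1)) μ y lam v| ≤ Cr * Real.exp (-(κb * supNorm (quo (Lc ^ (k + 1)) v - y))) := by
        refine (hr0 μ y lam v).trans ?_
        have : Cr * ((Lc : ℝ) ^ (5 * (k + 1)))⁻¹ ≤ Cr := mul_le_of_le_one_right hCr hp5
        exact mul_le_mul_of_nonneg_right this hE0
      have h2 : ∀ w, |Psi (toSite (ctrOff (3 + 1) Lc)) Lc (p + 1) k (fun μ' y' => if μ' = μ then (if y' = y then (1 : ℝ) else 0) else 0) w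
            + PsiFace (ctrOff (3 + 1) Lc) (toSite (ctrOff (3 + 1) Lc)) Lc (p + 1) k (fun μ' y' => if μ' = μ then (if y' = y then (1 : ℝ) else 0) else 0) w
            - bmGaugeAt (toSite (ctrOff (3 + 1) Lc)) (legAct (respStep (d := 3) (Lc ^ (p + 1)) (Lc ^ (p + 1 + k + 1)))
                (fun μ' y' => if μ' = μ then (if y' = y then (1 : ℝ) else 0) else 0)) Lc w|
          ≤ Cφ * Real.exp (-(κb * supNorm (quo (Lc ^ (k + 1)) w - y))) := by
        intro w
        refine (hφ0 μ y w).trans ?_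
        have : Cφ * ((Lc : ℝ) ^ (4 * (k + 1)))⁻¹ ≤ Cφ := mul_le_of_le_one_right hCφ hp4
        exact mul_le_mul_of_nonneg_right this (Real.exp_pos _).le
      -- the shifted potential: block label within one
      have hl1 : l1 (v + unitVec lam - v) = 1 := by
        rw [add_sub_cancel_left]
        unfold l1
        rw [Finset.sum_eq_single lam (fun j _ hj => by simp [B6BondElimination.unitVec_apply, hj]) (fun hh => (hh (Finset.mem_univ lam)).elim)]
        simp [B6BondElimination.unitVec_apply]
      have hw := env_wobble (d := 3) hk1 hκb.le y v (v + unitVec lam)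
      rw [hl1, mul_one] at hw
      have h3 := (h2 (v + unitVec lam)).trans (mul_le_mul_of_nonneg_left hw hCφ)
      have h4 := h2 v
      calc _ ≤ |respStep (d := 3) (Lc ^ (p + 1)) (Lc ^ (p + 1 + k + 1)) μ y lam v|
            + |(Psi (toSite (ctrOff (3 + 1) Lc)) Lc (p + 1) k (fun μ' y' => if μ' = μ then (if y' = y then (1 : ℝ) else 0) else 0) (v + unitVec lam)
                + PsiFace (ctrOff (3 + 1) Lc) (toSite (ctrOff (3 + 1) Lc)) Lc (p + 1) k (fun μ' y' => if μ' = μ then (if y' = y then (1 : ℝ) else 0) else 0) (v + unitVec lam)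
                - bmGaugeAt (toSite (ctrOff (3 + 1) Lc)) (legAct (respStep (d := 3) (Lc ^ (p + 1)) (Lc ^ (p + 1 + k + 1)))
                    (fun μ' y' => if μ' = μ then (if y' = y then (1 : ℝ) else 0) else 0)) Lc (v + unitVec lam))
              - (Psi (toSite (ctrOff (3 + 1) Lc)) Lc (p + 1) k (fun μ' y' => if μ' = μ then (if y' = y then (1 : ℝ) else 0) else 0) v
                + PsiFace (ctrOff (3 + 1) Lc) (toSite (ctrOff (3 + 1) Lc)) Lc (p + 1) k (fun μ' y' => if μ' = μ then (if y' = y then (1 : ℝ) else 0) else 0) v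
                - bmGaugeAt (toSite (ctrOff (3 + 1) Lc)) (legAct (respStep (d := 3) (Lc ^ (p + 1)) (Lc ^ (p + 1 + k + 1)))
                    (fun μ' y' => if μ' = μ then (if y' = y then (1 : ℝ) else 0) else 0)) Lc v)| := abs_add_le _ _
        _ ≤ Cr * Real.exp (-(κb * supNorm (quo (Lc ^ (k + 1)) v - y)))
            + (Cφ * (Real.exp κb * Real.exp (-(κb * supNorm (quo (Lc ^ (k + 1)) v - y)))) + Cφ * Real.exp (-(κb * supNorm (quo (Lc ^ (k + 1)) v - y)))) :=
            add_le_add h1 ((abs_sub _ _).trans (add_le_add h3 h4))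
        _ = A * Real.exp (-(κb * supNorm (quo (Lc ^ (k + 1)) v - y))) := by rw [hA]; ring
    -- the swapped family unrolls at its fine end: `colH M` below the natural chain
    have hdec : ∀ j, ∃ C' m' : ℝ, 0 < m' ∧ LegDecay ((fun j => colH (Function.update (fun j => unitK (sfStep Lc j) (smStep 3 Lc j)
          (GcombSh (d := 3) Lc j)) p M j) Lc) j) Lc C' m' :=
      fun j => ⟨max C CM, min δK δM, lt_min hδK hδM, legDecay_colH_update hKrow hM hC p j⟩
    have hcongr : legChain (fun j => colH (Function.update (fun j => unitK (sfStep Lc j) (smStep 3 Lc j)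
          (GcombSh (d := 3) Lc j)) p M j) Lc) (p + 1) k
        = legChain (fun j => colH (unitK (sfStep Lc j) (smStep 3 Lc j) (GcombSh (d := 3) Lc j)) Lc) (p + 1) k :=
      legChain_congr_from (fun j hj => by rw [Function.update_of_ne (show j ≠ p by omega)]) k
    have hunroll : legChain (fun j => colH (Function.update (fun j => unitK (sfStep Lc j) (smStep 3 Lc j)
          (GcombSh (d := 3) Lc j)) p M j) Lc) p (k + 1)
        = legComp (colH M Lc) (legChain (fun j => colH (unitK (sfStep Lc j) (smStep 3 Lc j) (GcombSh (d := 3) Lc j)) Lc) (p + 1) k) := by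
      rw [legChain_succ_left hLc1 hdec p k, hcongr]
      simp only [Function.update_self]
    -- the sup envelope (part 8b′ §2) and the crude gradient
    have hsup : ∀ v, |legChain (fun j => colH (Function.update (fun j => unitK (sfStep Lc j) (smStep 3 Lc j)
          (GcombSh (d := 3) Lc j)) p M j) Lc) p (k + 1) μ y κ v|
        ≤ CM * a₈ * Real.exp (-(κ₈ * supNorm (quo (Lc ^ (k + 1 + 1)) v - y))) := by
      intro v
      rw [hunroll]
      have h := abs_legComp_colH_le (d := 3) hLc1 k hA0 hκb.le hU hCM hδM hM μ y κ v
      rw [show k + 1 + 1 = k + 2 by ring, hκ₈]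
      refine h.trans (le_of_eq ?_)
      rw [ha₈]; ring
    exact ⟨hsup v, fun i => abs_sub_le_of_env (d := 3) hq1 (R := fun v => legChain (fun j => colH (Function.update (fun j => unitK (sfStep Lc j) (smStep 3 Lc j)
      (GcombSh (d := 3) Lc j)) p M j) Lc) p (k + 1) μ y κ v) (by positivity) hκ₈0.le y hsup v i⟩

end Summit.QuantumFields.BalabanUV.Beta.GAN24.CombCarrierSlotLegBottomKernelRate

end
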